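import Literature.Geometry.Lorentzian.CarterThresholdMonotone
import Literature.Geometry.Lorentzian.CarterHorizonPocket
import Literature.Geometry.Lorentzian.CarterFarEnvelope
import Literature.Geometry.Lorentzian.KerrTortoiseRadiusSurj
import HarnessLib

/-!
# The threshold barrier of Carter's equation in Breitenlohner–Freedman stable sectors
(namespace `Literature.Geometry.Lorentzian.Kerr`.)

Carter's radial equation `u″ + φ u = 0`, `φ = ω² − V ∘ ρ` (`V = Kerr.sepPotential M a ω m Λ`, `ρ` a
tortoise radius; DRSR arXiv:1402.7034 §5.2.3) AT THE SUPERRADIANT THRESHOLD `ω = mω₊` of a sub-extremal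
Kerr exterior. There `K = ω(r² − r₊²)` (`Kerr.Costa2019.radialK_eq_of_threshold`), so that in
`(r² + a²)²φ = K² − Δ(Λ − 2amω) − (r² + a²)²V₁` (`Kerr.sq_mul_coeff_eq`, `V₁ ≥ 0`) the first term is
`ω²(r − r₊)²(r + r₊)² ≤ Δ·ω²(r + r₊)²` (`Δ = (r − r₊)(r − r₋)`, `r − r₊ < r − r₋`):

* `sq_mul_coeff_le_of_threshold` — `(r² + a²)²φ ≤ −Δ·(Λ′ − ω²(r + r₊)²)`, `Λ′ := Λ − 2amω`, on
  `r ≥ r₊`: the coefficient is NON-POSITIVE (classically forbidden) as long as `ω²(r + r₊)² ≤ Λ′`, with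
  the quantitative rate `−φ ≥ Δ(Λ′ − ω²(r + r₊)²)/(r² + a²)²` (`coeff_le_of_threshold`,
  `coeff_nonpos_of_threshold`); in Breitenlohner–Freedman STABLE sectors `Λ′ > 4r₊²ω²` this barrier
  starts AT the horizon (`φ → 0⁻` as `r* → −∞`);
* `exists_Iic_eq_of_ordConnected_nonpos` — generic: a continuous `φ`, non-positive on `(−∞, A]`,
  positive on `[B, ∞)`, with `{φ ≤ 0}` order-connected, satisfies `{φ ≤ 0} = (−∞, b₂]` with
  `A ≤ b₂ < B`, `φ b₂ = 0` (threshold companion of `exists_Icc_eq_of_ordConnected_nonpos`);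
* `forbidden_interval_threshold` — the threshold companion of `Kerr.forbidden_interval`: GIVEN the
  census (`{r > r₊ : ω² ≤ V r}` order-connected) and `4r₊²ω² < Λ′`, `ω ≠ 0`: the forbidden set is
  `{s | φ s ≤ 0} = (−∞, b₂]` with `φ b₂ = 0`, `ρ b₂ < R = max(7M, √(12Λ)/|ω|, 1/(Mω²))`, and it contains
  every `s` with `ω²(ρ s + r₊)² ≤ Λ′` — so `ρ b₂ ≥ √Λ′/|ω| − r₊` (`le_rho_of_forbidden_threshold`), which
  under the margin `(1 + θ₁)(2r₊ω)² ≤ Λ′` is `≥ (2√(1 + θ₁) − 1)·r₊ ≥ (1 + θ₁/2)·r₊` for `θ₁ ≤ 8`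
  (`rPlus_mul_le_of_margin`): the threshold barrier reaches a κ-FREE distance beyond the horizon.

These are the census/geometry inputs (gaps G0, G1 of the near-extremal Kerr programme, crux
`KappaExplicitWaveDecay`, BF-stable large-`Λ` kernel bound) complementing the monotone growth of the
horizon solution along the same barrier (`CarterThresholdMonotone.lean`). Not here: anything off the
threshold (`ω ≠ mω₊`, where a small oscillatory cap precedes the barrier: `Kerr.forbidden_interval`).

## References
* M. Dafermos, I. Rodnianski, Y. Shlapentokh-Rothman, arXiv:1402.7034 = Ann. of Math. 183 (2016),
  §§5.2.3, 6.2–6.4 (key `DafermosRodnianskiShlapentokhrothman2014`).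
* R. Teixeira da Costa, Commun. Math. Phys. 378 (2020), §2.2 (key `Costa2019`). The assembly is folklore.
-/

noncomputable section

open Filter Set
open scoped _root_.Topology

namespace Literature.Geometry.Lorentzian

/-! ### The forbidden set of a continuous coefficient: non-positive left end, positive right end -/

/-- **Structure of an order-connected non-positivity set, half-line case.** Let `φ : ℝ → ℝ` be
continuous, non-positive on `(−∞, A]`, positive on `[B, ∞)`, with `{s | φ s ≤ 0}` order-connected. Then
`{s | φ s ≤ 0} = (−∞, b₂]` for some `A ≤ b₂ < B`, and `φ b₂ = 0`. [folklore] -/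
theorem exists_Iic_eq_of_ordConnected_nonpos {φ : ℝ → ℝ} (hcont : Continuous φ) {A B : ℝ}
    (hA : ∀ s, s ≤ A → φ s ≤ 0) (hB : ∀ s, B ≤ s → 0 < φ s)
    (hord : OrdConnected {s | φ s ≤ 0}) :
    ∃ b₂, A ≤ b₂ ∧ b₂ < B ∧ {s | φ s ≤ 0} = Iic b₂ ∧ φ b₂ = 0 := by
  set F := {s | φ s ≤ 0} with hF
  have hAF : A ∈ F := hA A le_rfl
  have hne : F.Nonempty := ⟨A, hAF⟩
  have hbdd : BddAbove F := by
    refine ⟨B, fun s hs ↦ le_of_lt (lt_of_not_ge fun h ↦ ?_)⟩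
    exact absurd hs (not_le.2 (hB s h))
  have hclosed : IsClosed F := isClosed_le hcont continuous_const
  set b₂ := sSup F with hb₂
  have hb₂F : b₂ ∈ F := hclosed.csSup_mem hne hbdd
  have hAb₂ : A ≤ b₂ := le_csSup hbdd hAF
  have hb₂B : b₂ < B := lt_of_not_ge fun h ↦ absurd hb₂F (not_le.2 (hB b₂ h))
  have hFeq : F = Iic b₂ := by
    apply Subset.antisymm
    · intro s hs; exact le_csSup hbdd hs
    · intro s hs
      have h1 : min s A ∈ F := hA _ (min_le_right _ _)
      exact hord.out h1 hb₂F ⟨min_le_left _ _, hs⟩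
  -- the end value vanishes (continuity)
  have hzero : φ b₂ = 0 := by
    rcases (show φ b₂ ≤ 0 from hb₂F).eq_or_lt with h | h
    · exact h
    · exfalso
      have hev : ∀ᶠ s in 𝓝 b₂, φ s < 0 := hcont.continuousAt.eventually (gt_mem_nhds h)
      obtain ⟨s, hs, hsb⟩ := ((hev.filter_mono nhdsWithin_le_nhds).and
        (self_mem_nhdsWithin (s := Ioi b₂))).exists
      have : s ≤ b₂ := le_csSup hbdd hs.le
      exact absurd this (not_le.2 hsb)
  exact ⟨b₂, hAb₂, hb₂B, hFeq, hzero⟩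

namespace Kerr

/-! ### The coefficient at the threshold: `(r² + a²)²φ ≤ −Δ(Λ′ − ω²(r + r₊)²)` -/

/-- **Carter's coefficient at the threshold, upper bound.** For `|a| < M`, `ω = mω₊` and `r ≥ r₊`:
`(r² + a²)²(ω² − V(r)) ≤ −Δ(r)·(Λ − 2amω − ω²(r + r₊)²)` — from
`(r² + a²)²(ω² − V) = K² − ΔΛ′ − (r² + a²)²V₁`, `K = ω(r² − r₊²)`, `(r − r₊)² ≤ Δ` and `V₁ ≥ 0`.
[folklore] -/
theorem sq_mul_coeff_le_of_threshold {M a ω Λ : ℝ} {m : ℤ} (ha : |a| < M)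
    (hω : ω = m * horizonAngularVelocity M a) {r : ℝ} (hr : rPlus M a ≤ r) :
    (r ^ 2 + a ^ 2) ^ 2 * (ω ^ 2 - sepPotential M a ω m Λ r) ≤
      -(delta M a r * (Λ - 2 * a * m * ω - ω ^ 2 * (r + rPlus M a) ^ 2)) := by
  have hM : 0 < M := lt_of_le_of_lt (abs_nonneg a) ha
  have hrp : 0 < rPlus M a := rPlus_pos hM a
  have hr0 : 0 < r := hrp.trans_le hr
  have hA : r ^ 2 + a ^ 2 ≠ 0 := by positivity
  have hV₁ : 0 ≤ (r ^ 2 + a ^ 2) ^ 2 * sepPotential₁ M a r :=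
    mul_nonneg (sq_nonneg _) (sepPotential₁_nonneg ha.le hr)
  have hK : radialK a ω m r = ω * (r ^ 2 - rPlus M a ^ 2) := Costa2019.radialK_eq_of_threshold ha hω r
  have hΔ : delta M a r = (r - rPlus M a) * (r - rMinus M a) := delta_eq_mul ha.le r
  have h1 : 0 ≤ r - rPlus M a := sub_nonneg.2 hr
  have h2 : r - rPlus M a ≤ r - rMinus M a := by linarith [rMinus_le_rPlus M a]
  -- `K² = ω²(r + r₊)²(r − r₊)² ≤ ω²(r + r₊)²·Δ`
  have hK2 : radialK a ω m r ^ 2 ≤ delta M a r * (ω ^ 2 * (r + rPlus M a) ^ 2) := by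
    rw [hK, hΔ]
    have e : (ω * (r ^ 2 - rPlus M a ^ 2)) ^ 2 =
        (r - rPlus M a) * (r - rPlus M a) * (ω ^ 2 * (r + rPlus M a) ^ 2) := by ring
    rw [e]
    exact mul_le_mul_of_nonneg_right (mul_le_mul_of_nonneg_left h2 h1) (by positivity)
  rw [sq_mul_coeff_eq M a ω m Λ hA]
  nlinarith [hK2, hV₁]

/-- **Carter's coefficient at the threshold, rate form**: for `|a| < M`, `ω = mω₊`, `r ≥ r₊`,
`ω² − V(r) ≤ −Δ(r)(Λ − 2amω − ω²(r + r₊)²)/(r² + a²)²`. [folklore] -/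
theorem coeff_le_of_threshold {M a ω Λ : ℝ} {m : ℤ} (ha : |a| < M)
    (hω : ω = m * horizonAngularVelocity M a) {r : ℝ} (hr : rPlus M a ≤ r) :
    ω ^ 2 - sepPotential M a ω m Λ r ≤
      -(delta M a r * (Λ - 2 * a * m * ω - ω ^ 2 * (r + rPlus M a) ^ 2)) / (r ^ 2 + a ^ 2) ^ 2 := by
  have hM : 0 < M := lt_of_le_of_lt (abs_nonneg a) ha
  have hrp : 0 < rPlus M a := rPlus_pos hM a
  have hr0 : 0 < r := hrp.trans_le hr
  have hA : 0 < (r ^ 2 + a ^ 2) ^ 2 := by positivity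
  rw [le_div_iff₀ hA, mul_comm]
  exact sq_mul_coeff_le_of_threshold ha hω hr

/-- **The threshold barrier**: for `|a| < M`, `ω = mω₊` and `r ≥ r₊` with `ω²(r + r₊)² ≤ Λ − 2amω`,
Carter's coefficient is non-positive, `ω² − V(r) ≤ 0` (classically forbidden; in BF-stable sectors
`Λ − 2amω > 4r₊²ω²` this holds on a whole collar of the horizon). [folklore] -/
theorem coeff_nonpos_of_threshold {M a ω Λ : ℝ} {m : ℤ} (ha : |a| < M)
    (hω : ω = m * horizonAngularVelocity M a) {r : ℝ} (hr : rPlus M a ≤ r)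
    (hb : ω ^ 2 * (r + rPlus M a) ^ 2 ≤ Λ - 2 * a * m * ω) :
    ω ^ 2 - sepPotential M a ω m Λ r ≤ 0 := by
  have hM : 0 < M := lt_of_le_of_lt (abs_nonneg a) ha
  have hrp : 0 < rPlus M a := rPlus_pos hM a
  have hr0 : 0 < r := hrp.trans_le hr
  have hA : 0 < (r ^ 2 + a ^ 2) ^ 2 := by positivity
  have hΔ : 0 ≤ delta M a r := delta_nonneg ha.le hr
  have h := sq_mul_coeff_le_of_threshold (Λ := Λ) ha hω hr
  have h2 : 0 ≤ delta M a r * (Λ - 2 * a * m * ω - ω ^ 2 * (r + rPlus M a) ^ 2) :=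
    mul_nonneg hΔ (by linarith)
  by_contra hcon
  push Not at hcon
  have : 0 < (r ^ 2 + a ^ 2) ^ 2 * (ω ^ 2 - sepPotential M a ω m Λ r) := mul_pos hA hcon
  linarith

/-! ### The forbidden set at the threshold, given the census -/

section Structural

variable {M a ω Λ : ℝ} {m : ℤ} {ρ : ℝ → ℝ}

/-- **The forbidden set in the tortoise variable at the threshold.** For a tortoise radius `ρ` of a
sub-extremal Kerr exterior, an admissible triple with `ω = mω₊ ≠ 0` in a Breitenlohner–Freedman stable
sector `4r₊²ω² < Λ − 2amω`, and the census `{r > r₊ : ω² ≤ V r}` order-connected: with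
`R = max(7M, √(12Λ)/|ω|, 1/(Mω²))`, the forbidden set of `φ = ω² − V∘ρ` is a half-line
`{s | φ s ≤ 0} = (−∞, b₂]` with `ρ b₂ < R`, `φ b₂ = 0`, containing every `s` with
`ω²(ρ s + r₊)² ≤ Λ − 2amω`. [folklore] -/
theorem forbidden_interval_threshold (hρ : IsTortoiseRadius M a ρ) (hMa : IsSubextremal M a)
    (hadm : IsAdmissibleTriple a ω m Λ) (hωth : ω = m * horizonAngularVelocity M a) (hω : ω ≠ 0)
    (hBF : 4 * rPlus M a ^ 2 * ω ^ 2 < Λ - 2 * a * m * ω)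
    (hord : (Ioi (rPlus M a) ∩ {r : ℝ | ω ^ 2 ≤ sepPotential M a ω m Λ r}).OrdConnected) :
    ∃ b₂, ρ b₂ < max (7 * M) (max (Real.sqrt (12 * Λ) / |ω|) (1 / (M * ω ^ 2))) ∧
      {s | ω ^ 2 - sepPotential M a ω m Λ (ρ s) ≤ 0} = Iic b₂ ∧
      ω ^ 2 - sepPotential M a ω m Λ (ρ b₂) = 0 ∧
      ∀ s, ω ^ 2 * (ρ s + rPlus M a) ^ 2 ≤ Λ - 2 * a * m * ω → s ≤ b₂ := by
  have hM : 0 < M := hMa.pos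
  have ha : |a| < M := hMa
  have hrp : 0 < rPlus M a := rPlus_pos hM a
  set R := max (7 * M) (max (Real.sqrt (12 * Λ) / |ω|) (1 / (M * ω ^ 2))) with hRdef
  set φ : ℝ → ℝ := fun s ↦ ω ^ 2 - sepPotential M a ω m Λ (ρ s) with hφdef
  have hcont : Continuous φ := continuous_iff_continuousAt.2 fun s ↦
    (hρ.hasDerivAt_omega_sq_sub_sepPotential hMa ω m Λ s).continuousAt
  -- the barrier contains every `s` with `ω²(ρ s + r₊)² ≤ Λ′`
  have hin : ∀ s, ω ^ 2 * (ρ s + rPlus M a) ^ 2 ≤ Λ - 2 * a * m * ω → φ s ≤ 0 := fun s hs ↦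
    coeff_nonpos_of_threshold ha hωth (hρ.rPlus_lt s).le hs
  -- a left end: `ρ → r₊` at `−∞` and `4r₊²ω² < Λ′`
  have hω2 : 0 < ω ^ 2 := by positivity
  obtain ⟨δ, hδ, hδΛ⟩ : ∃ δ, 0 < δ ∧ ω ^ 2 * (2 * rPlus M a + δ) ^ 2 ≤ Λ - 2 * a * m * ω := by
    -- continuity of `δ ↦ ω²(2r₊ + δ)²` at `0`
    have hc : Continuous fun δ : ℝ ↦ ω ^ 2 * (2 * rPlus M a + δ) ^ 2 := by fun_prop
    have h0 : ω ^ 2 * (2 * rPlus M a + 0) ^ 2 < Λ - 2 * a * m * ω := by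
      rw [add_zero]; nlinarith
    have hev := hc.continuousAt.eventually (gt_mem_nhds h0)
    obtain ⟨δ, hδ, hδpos⟩ := ((hev.filter_mono nhdsWithin_le_nhds).and
      (self_mem_nhdsWithin (s := Ioi (0 : ℝ)))).exists
    exact ⟨δ, hδpos, hδ.le⟩
  have hAp : rPlus M a < rPlus M a + δ := lt_add_of_pos_right _ hδ
  obtain ⟨A, hA⟩ := hρ.exists_apply_eq hAp
  have hleft : ∀ s, s ≤ A → φ s ≤ 0 := by
    intro s hs
    apply hin
    have h1 : ρ s ≤ rPlus M a + δ := by rw [← hA]; exact (hρ.strictMono hMa).monotone hs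
    have h2 : 0 ≤ ρ s + rPlus M a := by linarith [hρ.rPlus_lt s]
    have h3 : ρ s + rPlus M a ≤ 2 * rPlus M a + δ := by linarith
    calc ω ^ 2 * (ρ s + rPlus M a) ^ 2 ≤ ω ^ 2 * (2 * rPlus M a + δ) ^ 2 :=
          mul_le_mul_of_nonneg_left (pow_le_pow_left₀ h2 h3 2) hω2.le
      _ ≤ Λ - 2 * a * m * ω := hδΛ
  -- the far point `xR` with `ρ xR = R`: `φ > 0` beyond
  have hR7 : 7 * M ≤ R := le_max_left _ _
  have hRp : rPlus M a < R := lt_of_lt_of_le (by linarith [rPlus_le_two_mul_self hM.le a]) hR7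
  obtain ⟨xR, hxR⟩ := hρ.exists_apply_eq hRp
  have hright : ∀ s, xR ≤ s → 0 < φ s := by
    intro s hs
    have hs' : R ≤ ρ s := by rw [← hxR]; exact (hρ.strictMono hMa).monotone hs
    have h := half_sq_le_omega_sq_sub_sepPotential hMa hω hadm hs'
    show 0 < ω ^ 2 - sepPotential M a ω m Λ (ρ s)
    linarith
  -- the census in the tortoise variable
  have hordφ : OrdConnected {s | φ s ≤ 0} := by
    refine ⟨fun s₁ hs₁ s₂ hs₂ s hs ↦ ?_⟩
    have h1 : ρ s₁ ∈ Ioi (rPlus M a) ∩ {r : ℝ | ω ^ 2 ≤ sepPotential M a ω m Λ r} :=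
      ⟨hρ.rPlus_lt s₁, show ω ^ 2 ≤ _ from sub_nonpos.1 hs₁⟩
    have h2 : ρ s₂ ∈ Ioi (rPlus M a) ∩ {r : ℝ | ω ^ 2 ≤ sepPotential M a ω m Λ r} :=
      ⟨hρ.rPlus_lt s₂, show ω ^ 2 ≤ _ from sub_nonpos.1 hs₂⟩
    have h := hord.out h1 h2 ⟨(hρ.strictMono hMa).monotone hs.1, (hρ.strictMono hMa).monotone hs.2⟩
    have h2' : ω ^ 2 ≤ sepPotential M a ω m Λ (ρ s) := h.2
    exact sub_nonpos.2 h2'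
  obtain ⟨b₂, -, hb₂R, hF, hφ₂⟩ := exists_Iic_eq_of_ordConnected_nonpos hcont hleft hright hordφ
  refine ⟨b₂, ?_, hF, hφ₂, fun s hs ↦ ?_⟩
  · rw [← hxR]; exact (hρ.lt_iff_lt hMa).2 hb₂R
  · have : s ∈ {s | φ s ≤ 0} := hin s hs
    rw [hF] at this
    exact this

/-- **The threshold barrier reaches `√Λ′/|ω| − r₊`.** Under the hypotheses of
`forbidden_interval_threshold`, with `b₂` the right end of the forbidden half-line:
`√(Λ − 2amω)/|ω| − r₊ ≤ ρ b₂`. [folklore] -/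
theorem le_rho_of_forbidden_threshold (hρ : IsTortoiseRadius M a ρ) (hMa : IsSubextremal M a)
    (hω : ω ≠ 0) {b₂ : ℝ}
    (hb₂ : ∀ s, ω ^ 2 * (ρ s + rPlus M a) ^ 2 ≤ Λ - 2 * a * m * ω → s ≤ b₂) :
    Real.sqrt (Λ - 2 * a * m * ω) / |ω| - rPlus M a ≤ ρ b₂ := by
  have hω0 : 0 < |ω| := abs_pos.2 hω
  rcases le_or_gt (Real.sqrt (Λ - 2 * a * m * ω) / |ω| - rPlus M a) (rPlus M a) with h | h
  · exact h.trans (hρ.rPlus_lt b₂).le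
  · obtain ⟨s, hs⟩ := hρ.exists_apply_eq h
    have hΛ0 : 0 ≤ Λ - 2 * a * m * ω := by
      by_contra hneg
      push Not at hneg
      have : Real.sqrt (Λ - 2 * a * m * ω) = 0 := Real.sqrt_eq_zero'.2 hneg.le
      rw [this, zero_div] at h
      linarith [rPlus_pos hMa.pos a]
    have hsb : s ≤ b₂ := by
      apply hb₂
      have e : ρ s + rPlus M a = Real.sqrt (Λ - 2 * a * m * ω) / |ω| := by rw [hs]; ring
      rw [e, div_pow, Real.sq_sqrt hΛ0, sq_abs, mul_div_cancel₀ _ (pow_ne_zero 2 hω)]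
    rw [← hs]
    exact (hρ.strictMono hMa).monotone hsb

end Structural

/-- **Margin arithmetic.** If `(1 + θ₁)(2r₊ω)² ≤ Λ′` with `0 ≤ θ₁ ≤ 8`, `ω ≠ 0`, then
`(1 + θ₁/2)·r₊ ≤ √Λ′/|ω| − r₊` (since `2√(1 + θ₁) ≥ 2 + θ₁/2` for `θ₁ ≤ 8`): in BF-stable sectors with
margin the threshold barrier extends a κ-free distance `θ₁r₊/2` beyond the horizon radius. [folklore] -/
theorem rPlus_mul_le_of_margin {rp ω Λ' θ₁ : ℝ} (hω : ω ≠ 0) (hθ₀ : 0 ≤ θ₁)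
    (hθ₈ : θ₁ ≤ 8) (hBF : (1 + θ₁) * (2 * rp * ω) ^ 2 ≤ Λ') :
    (1 + θ₁ / 2) * rp ≤ Real.sqrt Λ' / |ω| - rp := by
  have hω0 : 0 < |ω| := abs_pos.2 hω
  have h1 : (2 + θ₁ / 2) ^ 2 ≤ 4 * (1 + θ₁) := by nlinarith
  -- `((2 + θ₁/2) r₊ |ω|)² ≤ (1 + θ₁)(2r₊ω)² ≤ Λ′`
  have h2 : ((2 + θ₁ / 2) * rp * |ω|) ^ 2 ≤ Λ' := by
    calc ((2 + θ₁ / 2) * rp * |ω|) ^ 2 = (2 + θ₁ / 2) ^ 2 * (rp ^ 2 * ω ^ 2) := by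
          rw [mul_pow, mul_pow, sq_abs]; ring
      _ ≤ 4 * (1 + θ₁) * (rp ^ 2 * ω ^ 2) := mul_le_mul_of_nonneg_right h1 (by positivity)
      _ = (1 + θ₁) * (2 * rp * ω) ^ 2 := by ring
      _ ≤ Λ' := hBF
  have h3 : (2 + θ₁ / 2) * rp * |ω| ≤ Real.sqrt Λ' := Real.le_sqrt_of_sq_le h2
  rw [le_sub_iff_add_le, le_div_iff₀ hω0]
  calc ((1 + θ₁ / 2) * rp + rp) * |ω| = (2 + θ₁ / 2) * rp * |ω| := by ring
    _ ≤ Real.sqrt Λ' := h3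

end Kerr

end Literature.Geometry.Lorentzian

end
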